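import Summits.QuantumFields.YangMills.Theorems.BalabanUVNodesN07Delta2OfRecordExists
import HarnessLib

/-!
# NODE N07 — def-Y's (3.134) DATUM `Δ2` IS UNIQUE UNDER `Delta2Tok ∧ Delta2SymmTok`, AND ITS REMAINING TOKEN `HessSymmTok Δ2` REDUCES TO THE REALITY OF `Δ2`
# (transpose-symmetric + real ⇒ Hilbert-symmetric) — the perfectness of the pairing (27) at the record

Cell `pub-ymgap`, width seat `pub-ymgap-dag-n07-w3` (g25), INTENT-12 ∕ CLAIM-12.  `--kind proof --supports stmt-QuantumFields-27238 --as helper`; count-neutral.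
[15] = [Balaban1985Variational]; [B9] = [Balaban1985BackgroundPropagators].

WHAT.  3g′ (✓`Node00.BgSchemeOfRecord`) says of its token `HessSymmTok Δ2 := (Δ(U₀) + Δ2).IsSymmetric`: «the content under the row's hypotheses `Delta2Tok ∧ Delta2SymmTok`
(which determine `Δ2` uniquely: `flat115` is a bijection, `currentCLM` is injective, `pair27 tr` is perfect) is the REALITY of print's `Δ⁽²⁾` — transpose-symmetric ⇒
Hilbert-symmetric».  This file proves exactly those structural sentences (✓p820… `N07Delta2OfRecordExists` gave existence):
* §1 `tpair_apply_comm_of_pair27_currentCLM_comm` ∕ `delta2SymmTok_iff_tpair_comm` — the (27)-symmetry of a read current at the carrier IS the bilinear-trace symmetry of the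
  `L²` operator (perfectness: `Y ↦ Ŷ` is onto, `η^d c₀⁻¹ ≠ 0`);
* §2 ★★ `eq_of_delta2Tok_of_delta2SymmTok` — TWO data with `Delta2Tok ∧ Delta2SymmTok` are EQUAL (polarization of a symmetric bilinear form with zero diagonal; `(f, g)_τ = ⟪f⋆, g⟫`
  is perfect);
* §3 `isSymmetric_of_tpair_comm_of_starW_comm` — an `L²` operator symmetric for the bilinear trace pairing AND real (`T(x⋆) = (Tx)⋆`) is Hilbert-symmetric;
  ★★ `hessSymmTok_of_delta2SymmTok_of_starW_comm` — `HessSymmTok Δ2 ⟸ Delta2SymmTok Δ2 ∧ (Δ2 real)`: what remains of 3g′'s third token for the (3.134) datum is the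
  REALITY of `Δ2` alone (i.e. of `C^{𝔰𝔩}`, `H♭`, `J` — not claimed here).

HONEST LABELS.  Finite-dimensional linear algebra over lit's constructed pairing; NO estimate, NO reality proof, NO formula for `Δ⁽²⁾`.  Count-neutral; N07 NOT discharged; P0 ⟨26900⟩
OPEN; R4 is the conditional finite-𝕋⁴ rung only.  Nothing here is a claim about the Yang–Mills mass gap (`Summit.QuantumFields`): finite torus, fixed `ε`; nothing continuum ∕ OS ∕ Clay.
-/

set_option autoImplicit false

noncomputable section

open scoped Matrix Matrix.Norms.L2Operator InnerProductSpace ComplexConjugate BigOperators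

namespace Summit.QuantumFields.YangMills.Theorems.N07Delta2OfRecordUnique

open Literature.MathematicalPhysics.QuantumFieldTheory.Balaban1983to89
open Literature.MathematicalPhysics.QuantumFieldTheory.Balaban1983to89.T4Continuum (T4Family)
open T4Continuum BlockAveraging
open B9SectCLatticeCarrier (Bond)
open B9Eq311L2Pairing (WL2)
open B9Eq311TracePairing (tpair starW starW_starW tpair_eq_inner_starW tpair_comm tpair_add_right)
open B11Eq111FrakG (nabla115 jetLinearEquiv)
open B11Eq103H1Complex (BondL2K funEquiv)
open B11Eq115Space (NegSup NegSize levWeight JetSup)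
open B11Eq90V0primeCurrent (flat115)
open B11Eq90Transpose (pair27)
open B9Eq3119DeltaPiCarrier (currentCLM)
open Node00
open Summit.QuantumFields.YangMills.Theorems.N07HessOpOfRecordSymmetric (tauRec_mul_comm hessOpOfRecord_add_isSymmetric)
open Summit.QuantumFields.YangMills.Theorems.N07Delta2OfRecordExists (pair27_currentCLM_eq_tpair)

variable (F : T4Family) (N : ℕ) (K : ℕ) (k : ℕ) (Ω : ℕ → Set (Site (F.P K) 0)) (U₀ : GaugeField (F.P K) 0 (SU N))

/-! ## §1  The (27)-symmetry at the carrier is the bilinear-trace symmetry on the `L²` side -/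

section Carrier

variable [Fact (0 < (F.L : ℝ))] [Fact (0 < (F.P K).eta k)] [Fact (0 < c0Rec F K k)]

omit [Fact (0 < c0Rec F K k)] in
/-- **`Y ↦ Ŷ` IS ONTO the record's `L²` bond space** (the configuration with underlying bond function `φ ∘ u` reads back to `u`). [cite: Balaban1985Variational, (115) p.294, (27) p.282] -/
theorem exists_hat_eq (u : BondL2K ℂ (F.P K).d (fun _ => (F.P K).sitesPerDir 0) (c0Rec F K k) (WRec N)) :
    ∃ Y : Space115Lit F N K k Ω U₀,
      (funEquiv (phiRec N) (fun _ : Bond (F.P K).d (fun _ => (F.P K).sitesPerDir 0) => c0Rec F K k)).symm (flat115 Y) = u := by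
  refine ⟨(jetLinearEquiv (F.L : ℝ) ((F.P K).eta k) (bondLevLit F Ω k) (pairLevLit F Ω k) (nabla115 ((F.P K).eta k) (unitsOfRecord F N U₀))).symm
    (funEquiv (phiRec N) (fun _ : Bond (F.P K).d (fun _ => (F.P K).sitesPerDir 0) => c0Rec F K k) u), ?_⟩
  have h : flat115 ((jetLinearEquiv (F.L : ℝ) ((F.P K).eta k) (bondLevLit F Ω k) (pairLevLit F Ω k) (nabla115 ((F.P K).eta k) (unitsOfRecord F N U₀))).symm
      (funEquiv (phiRec N) (fun _ : Bond (F.P K).d (fun _ => (F.P K).sitesPerDir 0) => c0Rec F K k) u)) =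
      funEquiv (phiRec N) (fun _ : Bond (F.P K).d (fun _ => (F.P K).sitesPerDir 0) => c0Rec F K k) u :=
    (jetLinearEquiv (F.L : ℝ) ((F.P K).eta k) (bondLevLit F Ω k) (pairLevLit F Ω k) (nabla115 ((F.P K).eta k) (unitsOfRecord F N U₀))).apply_symm_apply _
  rw [h, LinearEquiv.symm_apply_apply]

/-- ★ **THE (27)-SYMMETRY OF A READ CURRENT IS THE BILINEAR-TRACE SYMMETRY OF THE OPERATOR**: if `⟨T̂Y, Z⟩₍₂₇₎ = ⟨T̂Z, Y⟩₍₂₇₎` for all `Y, Z`, then `(x, T y)_τ = (y, T x)_τ` for all `x, y`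
(`Y ↦ Ŷ` onto, `η^d c₀⁻¹ ≠ 0`, cyclic trace). [cite: Balaban1985Variational, (27) p.282; Balaban1985BackgroundPropagators, (3.11) p.392, (3.134)–(3.135) p.422] -/
theorem tpair_apply_comm_of_pair27_currentCLM_comm
    {T : BondL2K ℂ (F.P K).d (fun _ => (F.P K).sitesPerDir 0) (c0Rec F K k) (WRec N) →ₗ[ℂ]
      BondL2K ℂ (F.P K).d (fun _ => (F.P K).sitesPerDir 0) (c0Rec F K k) (WRec N)}
    (h : ∀ Y Z : Space115Lit F N K k Ω U₀,
      pair27 (tauRecCLM N) (currentCLM (phiRec N) (pairLevLit F Ω k) (nabla115 ((F.P K).eta k) (unitsOfRecord F N U₀)) T Y) (flat115 Z) =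
        pair27 (tauRecCLM N) (currentCLM (phiRec N) (pairLevLit F Ω k) (nabla115 ((F.P K).eta k) (unitsOfRecord F N U₀)) T Z) (flat115 Y))
    (x y : BondL2K ℂ (F.P K).d (fun _ => (F.P K).sitesPerDir 0) (c0Rec F K k) (WRec N)) :
    tpair (phiRec N) (tauRec N) x (T y) = tpair (phiRec N) (tauRec N) y (T x) := by
  have hc₀ : (c0Rec F K k : ℂ)⁻¹ ≠ 0 := inv_ne_zero (by exact_mod_cast (Fact.out : 0 < c0Rec F K k).ne')
  have hη : ((((F.P K).eta k : ℝ) : ℂ)) ^ (F.P K).d ≠ 0 := pow_ne_zero _ (by exact_mod_cast (Fact.out : 0 < (F.P K).eta k).ne')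
  obtain ⟨Y, hY⟩ := exists_hat_eq F N K k Ω U₀ y
  obtain ⟨Z, hZ⟩ := exists_hat_eq F N K k Ω U₀ x
  have key := h Y Z
  rw [pair27_currentCLM_eq_tpair, pair27_currentCLM_eq_tpair, hY, hZ] at key
  have key' := mul_left_cancel₀ (mul_ne_zero hη hc₀) key
  -- `(T y, x)_τ = (T x, y)_τ`; flip both sides with the cyclic trace
  rw [tpair_comm (phiRec N) (tauRec N) (tauRec_mul_comm N) x, tpair_comm (phiRec N) (tauRec N) (tauRec_mul_comm N) y]
  exact key'

/-- **`Delta2SymmTok Δ2 ⟺ Δ2` IS SYMMETRIC FOR THE BILINEAR TRACE PAIRING** (§1 with ✓`delta2SymmTok_of_tpair_comm`). [cite: Balaban1985BackgroundPropagators, (3.134)–(3.135) p.422] -/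
theorem delta2SymmTok_iff_tpair_comm [NeZero N]
    (Δ2 : BondL2K ℂ (F.P K).d (fun _ => (F.P K).sitesPerDir 0) (c0Rec F K k) (WRec N) →ₗ[ℂ]
      BondL2K ℂ (F.P K).d (fun _ => (F.P K).sitesPerDir 0) (c0Rec F K k) (WRec N)) :
    Delta2SymmTok F N K k Ω U₀ Δ2 ↔ ∀ x y, tpair (phiRec N) (tauRec N) x (Δ2 y) = tpair (phiRec N) (tauRec N) y (Δ2 x) :=
  ⟨fun h => tpair_apply_comm_of_pair27_currentCLM_comm F N K k Ω U₀ h,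
    Summit.QuantumFields.YangMills.Theorems.N07SchemeTokensOfRecord.delta2SymmTok_of_tpair_comm F N K k Ω U₀⟩

end Carrier

/-! ## §2  Uniqueness of the (3.134) datum -/

section Unique

variable [NeZero N] [Fact (0 < (F.L : ℝ))] [Fact (0 < (F.P K).eta k)] [Fact (0 < c0Rec F K k)] [Fact (∀ c, 0 < wBRec F K k c)]

omit [NeZero N] [Fact (0 < (F.L : ℝ))] [Fact (0 < (F.P K).eta k)] [Fact (∀ c, 0 < wBRec F K k c)] in
/-- **THE BILINEAR TRACE PAIRING IS PERFECT**: `(f, v)_τ = (g, v)_τ` for all `v` forces `f = g` (`(f, v)_τ = ⟪f⋆, v⟫`, `⋆` involutive).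
[cite: Balaban1985BackgroundPropagators, (3.11) p.392] -/
theorem eq_of_tpair_eq {f g : BondL2K ℂ (F.P K).d (fun _ => (F.P K).sitesPerDir 0) (c0Rec F K k) (WRec N)}
    (h : ∀ v, tpair (phiRec N) (tauRec N) f v = tpair (phiRec N) (tauRec N) g v) : f = g := by
  have hs : starW (phiRec N) f = starW (phiRec N) g := by
    apply ext_inner_right ℂ
    intro v
    rw [← tpair_eq_inner_starW (phiRec N) (tauRec N) inner_phiRec_symm, ← tpair_eq_inner_starW (phiRec N) (tauRec N) inner_phiRec_symm, h v]
  rw [← starW_starW (phiRec N) f, hs, starW_starW]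

/-- ★★ **UNIQUENESS OF `Δ⁽²⁾`: two data with `Delta2Tok ∧ Delta2SymmTok` are equal** — their difference has a (27)-pairing form that is symmetric with zero diagonal, hence
zero by polarization, and the pairing is perfect. [cite: Balaban1985BackgroundPropagators, (3.134)–(3.135) p.422; Balaban1985Variational, (27) p.282] -/
theorem eq_of_delta2Tok_of_delta2SymmTok (levB : PBond (F.P K) k → ℕ) (a : ℝ)
    (hposb : ∀ x, x ≠ 0 → 0 < RCLike.re ⟪x, laplaceAOfRecord F N k U₀ (QOfRecord F N k U₀) (QflatOfRecord F N k) a x⟫_ℂ)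
    (hQ : Function.Surjective (QOfRecord F N k U₀))
    {Δ2 Δ2' : BondL2K ℂ (F.P K).d (fun _ => (F.P K).sitesPerDir 0) (c0Rec F K k) (WRec N) →ₗ[ℂ]
      BondL2K ℂ (F.P K).d (fun _ => (F.P K).sitesPerDir 0) (c0Rec F K k) (WRec N)}
    (h₁ : Delta2Tok F N K k Ω U₀ levB a hposb hQ Δ2) (h₁s : Delta2SymmTok F N K k Ω U₀ Δ2)
    (h₂ : Delta2Tok F N K k Ω U₀ levB a hposb hQ Δ2') (h₂s : Delta2SymmTok F N K k Ω U₀ Δ2') : Δ2 = Δ2' := by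
  have hc₀ : (c0Rec F K k : ℂ)⁻¹ ≠ 0 := inv_ne_zero (by exact_mod_cast (Fact.out : 0 < c0Rec F K k).ne')
  have hη : ((((F.P K).eta k : ℝ) : ℂ)) ^ (F.P K).d ≠ 0 := pow_ne_zero _ (by exact_mod_cast (Fact.out : 0 < (F.P K).eta k).ne')
  have hs₁ := (delta2SymmTok_iff_tpair_comm F N K k Ω U₀ Δ2).1 h₁s
  have hs₂ := (delta2SymmTok_iff_tpair_comm F N K k Ω U₀ Δ2').1 h₂s
  have hcomm : ∀ f g : BondL2K ℂ (F.P K).d (fun _ => (F.P K).sitesPerDir 0) (c0Rec F K k) (WRec N),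
      tpair (phiRec N) (tauRec N) f g = tpair (phiRec N) (tauRec N) g f := fun f g => tpair_comm (phiRec N) (tauRec N) (tauRec_mul_comm N) f g
  have haddl : ∀ f₁ f₂ g : BondL2K ℂ (F.P K).d (fun _ => (F.P K).sitesPerDir 0) (c0Rec F K k) (WRec N),
      tpair (phiRec N) (tauRec N) (f₁ + f₂) g = tpair (phiRec N) (tauRec N) f₁ g + tpair (phiRec N) (tauRec N) f₂ g := fun f₁ f₂ g => by
    rw [hcomm, tpair_add_right, hcomm g, hcomm g]
  -- zero diagonal of the difference, from (3.134) for both data read on the `L²` side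
  have hdiag : ∀ u, tpair (phiRec N) (tauRec N) u (Δ2 u) = tpair (phiRec N) (tauRec N) u (Δ2' u) := fun u => by
    obtain ⟨A, hA⟩ := exists_hat_eq F N K k Ω U₀ u
    have key := (h₁ A).trans (h₂ A).symm
    rw [pair27_currentCLM_eq_tpair, pair27_currentCLM_eq_tpair, hA] at key
    have key' := mul_left_cancel₀ (mul_ne_zero hη hc₀) key
    rw [hcomm u (Δ2 u), hcomm u (Δ2' u)]
    exact key'
  -- expansion of the diagonal at `u + v`
  have hexp : ∀ (T : BondL2K ℂ (F.P K).d (fun _ => (F.P K).sitesPerDir 0) (c0Rec F K k) (WRec N) →ₗ[ℂ]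
      BondL2K ℂ (F.P K).d (fun _ => (F.P K).sitesPerDir 0) (c0Rec F K k) (WRec N)) (u v),
      tpair (phiRec N) (tauRec N) (u + v) (T (u + v)) =
        tpair (phiRec N) (tauRec N) u (T u) + tpair (phiRec N) (tauRec N) v (T u) +
          (tpair (phiRec N) (tauRec N) u (T v) + tpair (phiRec N) (tauRec N) v (T v)) := fun T u v => by
    rw [map_add, tpair_add_right, haddl, haddl]
  -- polarization: the symmetric form `(u, (Δ2 − Δ2′) v)_τ` with zero diagonal vanishes
  have hb : ∀ u v, tpair (phiRec N) (tauRec N) u (Δ2 v) = tpair (phiRec N) (tauRec N) u (Δ2' v) := fun u v => by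
    have h0 := hdiag (u + v)
    rw [hexp Δ2 u v, hexp Δ2' u v, hdiag u, hdiag v, hs₁ v u, hs₂ v u] at h0
    linear_combination (2 : ℂ)⁻¹ * h0
  refine LinearMap.ext fun v => eq_of_tpair_eq F N K k fun u => ?_
  rw [hcomm (Δ2 v) u, hcomm (Δ2' v) u, hb]

end Unique

/-! ## §3  `HessSymmTok Δ2` reduces to the reality of `Δ2` -/

section Reality

variable [NeZero N] [Fact (0 < (F.L : ℝ))] [Fact (0 < (F.P K).eta k)] [Fact (0 < c0Rec F K k)]

omit [NeZero N] [Fact (0 < (F.L : ℝ))] [Fact (0 < (F.P K).eta k)] in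
/-- **TRANSPOSE-SYMMETRIC + REAL ⇒ HILBERT-SYMMETRIC**: an operator on the record's `L²` bond space symmetric for the bilinear trace pairing which commutes with the fibrewise `⋆`
is symmetric for the Hermitian scalar product (`⟪Tx, y⟫ = ((Tx)⋆, y)_τ = (T x⋆, y)_τ = (x⋆, T y)_τ = ⟪x, T y⟫`). [cite: Balaban1985BackgroundPropagators, (3.10)–(3.11) p.392, (3.135) p.422] -/
theorem isSymmetric_of_tpair_comm_of_starW_comm
    {T : BondL2K ℂ (F.P K).d (fun _ => (F.P K).sitesPerDir 0) (c0Rec F K k) (WRec N) →ₗ[ℂ]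
      BondL2K ℂ (F.P K).d (fun _ => (F.P K).sitesPerDir 0) (c0Rec F K k) (WRec N)}
    (hT : ∀ x y, tpair (phiRec N) (tauRec N) x (T y) = tpair (phiRec N) (tauRec N) y (T x)) (hreal : ∀ x, starW (phiRec N) (T x) = T (starW (phiRec N) x)) :
    T.IsSymmetric := by
  intro x y
  rw [← starW_starW (phiRec N) (T x), ← tpair_eq_inner_starW (phiRec N) (tauRec N) inner_phiRec_symm, hreal,
    tpair_comm (phiRec N) (tauRec N) (tauRec_mul_comm N), hT, tpair_eq_inner_starW (phiRec N) (tauRec N) inner_phiRec_symm, starW_starW]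

/-- ★★ **`HessSymmTok Δ2 ⟸ Delta2SymmTok Δ2 ∧ (Δ2 REAL)`** — 3g′'s third token for the (3.134) datum holds as soon as `Δ2` commutes with the fibrewise `⋆` (`Δ(U₀)` is Hilbert-symmetric
at every background, ✓p819846; `Δ2` is then Hilbert-symmetric by §1 and the lemma above).  The reality of `Δ2` (that of `C^{𝔰𝔩}`, `H♭`, `J`) is NOT claimed.
[cite: Balaban1985BackgroundPropagators, (3.124) p.420, (3.128) p.421, (3.134)–(3.135) p.422] -/
theorem hessSymmTok_of_delta2SymmTok_of_starW_comm
    {Δ2 : BondL2K ℂ (F.P K).d (fun _ => (F.P K).sitesPerDir 0) (c0Rec F K k) (WRec N) →ₗ[ℂ]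
      BondL2K ℂ (F.P K).d (fun _ => (F.P K).sitesPerDir 0) (c0Rec F K k) (WRec N)}
    (hs : Delta2SymmTok F N K k Ω U₀ Δ2) (hreal : ∀ x, starW (phiRec N) (Δ2 x) = Δ2 (starW (phiRec N) x)) : HessSymmTok F N K k U₀ Δ2 :=
  hessOpOfRecord_add_isSymmetric F N k U₀
    (isSymmetric_of_tpair_comm_of_starW_comm F N K k ((delta2SymmTok_iff_tpair_comm F N K k Ω U₀ Δ2).1 hs) hreal)

end Reality

end Summit.QuantumFields.YangMills.Theorems.N07Delta2OfRecordUnique
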